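import Literature.Geometry.Riemannian.LowEntropyHypersurfacesFourProofs
import HarnessLib

/-!
# Low-entropy hypersurfaces of `ℝ⁵` (Chodosh–Mantoulidis–Schulze 2025, Cor. 1.5 for `n = 4`):
# the two printed halves as named facts, and the assembly

Companion of `LowEntropyHypersurfacesFour.lean` (the named fact
`ChodoshMantoulidisSchulze2025_lowEntropy_sphere_four`, the conjunction of the diffeomorphism
consequences of Cor. 1.5 (a) and (b) of O. Chodosh, C. Mantoulidis, F. Schulze, *Mean curvature
flow with generic low-entropy initial data II*, Duke Math. J. 174 (2025), arXiv:2309.03856, for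
`n = 4`) and of `LowEntropyHypersurfacesFourProofs.lean` (the proved differential-topological steps).
The parent joins two printed statements with DIFFERENT proofs (proof of Cor. 1.22, p. 6):

* (a) `λ(M) ≤ λ(𝕊³)`: "perhaps after a small initial `C^∞` perturbation … the mean curvature flow
  is completely smooth until it becomes a round sphere" — an honest classical mean curvature flow,
  which the tree can now state (`IsClassicalMCF`, `MeanConvexLevelSetFlow.lean`, inhabited by the
  shrinking spheres `ShrinkingSphereMCF.lean`; Huisken's monotonicity `HuiskenMonotonicity.lean`;
  entropy monotone along classical flows `MCFEntropyMonotonicity.lean`); "becomes a round sphere"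
  = extinction at a round point: after Huisken's rescaling `(T − t)^{−1/2}(· − c)` the embeddings
  converge smoothly to an embedding onto the round sphere of radius `√(2n) = √8`
  ([Huisken1984, Thm. 1.1 and §10]);
* (b) `λ(M) ≤ λ(𝕊²)`: the flow WITH SURGERY of Daniels-Holgate — not statable in the tree when
  this file was written (no surgery; it is now, see "Status of (b)" below); for simply connected
  `M` its printed conclusion is `M ≅ 𝕊⁴`.

Accordingly this file names:

* `ChodoshMantoulidisSchulze2025_smoothFlow_roundPoint_four` — (a) as a FLOW statement in the
  tree's vocabulary: from every `C⁰`-small perturbation class of `ι` a classical MCF of embedded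
  copies of `M` runs smoothly on `[0, T)` and converges, rescaled about its extinction point, to a
  smooth embedding of `M` onto the round `𝕊⁴(√8)`;
* `ChodoshMantoulidisSchulze2025_cor15b_four` — (b) for simply connected `M` (the second conjunct
  of the parent, verbatim: a distinct printed statement whose proof needs the surgery);
* `ChodoshMantoulidisSchulze2025_lowEntropy_sphere_four_holds_of` — the assembly: the limit
  embedding of (a) has image a round sphere, so `M ≅ 𝕊⁴` by the PROVED isotopy-endpoint step
  `nonempty_diffeomorph_sphere_four_of_range_eq_sphere` (Lee, Cor. 5.30 / Thm. 5.31); (b) is (b).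

## Status of (b) (downstream files)

The flow with surgery of (b) has since been rendered, and the TOPOLOGICAL half of its printed
proof proved, downstream:

* `LowEntropyHypersurfacesFourNeckSurgery.lean` — Daniels-Holgate's flow with surgery with the
  standard caps attached along the necks (`MCFNeckSurgeryResolvable`, `MCFNeckSurgeryFlowFrom`),
  and `ChodoshMantoulidisSchulze2025_cor15b_four_of_neckSurgeryFlow` (**proved, no input from
  Cerf's `Γ₄ = 0`**): `ChodoshMantoulidisSchulze2025_cor15b_four` follows from the single ANALYTIC
  statement displayed there as the hypothesis `hflow` — the (b)-analogue of
  `ChodoshMantoulidisSchulze2025_smoothFlow_roundPoint_four` (Thm. 1.13 / Cor. 1.19 of the cited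
  paper with Daniels-Holgate 2022, Thm. 1.3 and Thm. 2.29, for every closed connected `M⁴ ⊂ ℝ⁵`
  with `λ ≤ λ(𝕊²)`), which is the statement to vend as a named fact when (b) is to be discharged
  (`ChodoshMantoulidisSchulze2025_cor15b_four_holds` is then one line); the parent follows from the
  two flow statements by `ChodoshMantoulidisSchulze2025_lowEntropy_sphere_four_of_flows` there;
* `LowEntropyHypersurfacesFourSurgery.lean` / `…SurgeryProofs.lean` — the earlier collared
  rendering (`MCFSurgeryResolvableIn`), whose reduction
  `ChodoshMantoulidisSchulze2025_cor15b_four_of_perturbedSurgeryFlow_of_cerf` needs in addition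
  `Literature.Topology.FourManifolds.cerf_pi0Diff_sphere_three`.

## References

* [ChodoshMantoulidisSchulze2025] O. Chodosh, C. Mantoulidis, F. Schulze, arXiv:2309.03856 / Duke
  Math. J. 174 (2025): Cor. 1.5, Thm. 1.13, Thm. 1.17, Cor. 1.19, Cor. 1.22 and its proof (§1.6, p. 6).
* [Huisken1984] G. Huisken, *Flow by mean curvature of convex surfaces into spheres*, J. Differential
  Geom. 20 (1984) 237–266, Thm. 1.1 and §10 (convergence of the rescaled immersions).
* [DanielsHolgate2022] J. M. Daniels-Holgate, Adv. Math. 410 (2022) (surgery, case (b)).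
-/

noncomputable section

open Set Function Metric Module Filter
open scoped Manifold ContDiff Topology

namespace Literature.Geometry.Riemannian

/-- **Chodosh–Mantoulidis–Schulze 2025, Cor. 1.5 (a) / Cor. 1.22 (a) for `n = 4`, as a flow**
(proof of Cor. 1.22, p. 6: "either `M` is a round sphere … or we can find a small `C^∞` graph `M'`
over `M` so that `λ(M') < Λ` and so that there is `ℳ' ∈ 𝔉(M')` with `sing_non-gen ℳ' = ∅`. Then, in
case (a), we have `λ(ℳ') < λ(𝕊ⁿ⁻¹)` so `ℳ'` can only have multiplicity-one `𝕊ⁿ`-type singularities.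
Thus, the mean curvature flow is completely smooth until it becomes a round sphere"), with
"becomes a round sphere" read through [Huisken1984, Thm. 1.1 and §10] (extinction at a round point:
the immersions rescaled by `(T − t)^{−1/2}` about the singular point converge smoothly to an
immersion onto the round sphere of radius `√(2n)`). Tree form, over the classical flows
`IsClassicalMCF` of `MeanConvexLevelSetFlow.lean` in `(ℝ⁵, euclideanMetric)`: let `M` be a compact
connected `C^∞` `4`-manifold and `ι : M → ℝ⁵` a `C^∞` embedding with
`λ(ι(M)) ≤ λ(shrinkingCylinder 4 3)` (`= λ(𝕊³)`, `Stone1994_cylinderEntropy_holds`). Then for every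
`ε > 0` there are a family `F : ℝ → M → ℝ⁵` with unit normals `ν`, a time `T > 0`, a centre
`c ∈ ℝ⁵` and a `C^∞` embedding `G : M → ℝ⁵` such that: `‖F 0 x − ι x‖ ≤ ε` for all `x` (the
perturbed initial hypersurface `M'`; `F 0` is an embedded copy of `M`); `F` is a classical mean
curvature flow of embedded hypersurfaces on `[0, b]` for every `b < T` (completely smooth until the
extinction time `T`); `G(M)` is the round sphere `sphere 0 √8`; and the rescaled embeddings
`x ↦ (T − t)^{−1/2} (F t x − c)` converge to `G` uniformly on `M` as `t ↑ T`. (Only uniform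
convergence and the embedding property of the limit are recorded; the printed convergence is
`C^∞`.) What a proof needs beyond the tree: Brakke flows and the class `𝔉(M)`, the perturbation
Thm. 1.13/1.17 of loc. cit., Colding–Minicozzi's generic singularities, Bernstein–Wang's
low-entropy classification, Brakke–White regularity, and Huisken 1984.
[cite: ChodoshMantoulidisSchulze2025, Cor. 1.22 (a), proof p. 6] [cite: Huisken1984, Thm. 1.1 and §10] -/
def ChodoshMantoulidisSchulze2025_smoothFlow_roundPoint_four : Prop :=
  ∀ (M : Type) [TopologicalSpace M] [T2Space M] [SecondCountableTopology M] [CompactSpace M]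
    [ConnectedSpace M] [ChartedSpace (EuclideanSpace ℝ (Fin 4)) M] [IsManifold (𝓡 4) ∞ M]
    (ι : M → EuclideanSpace ℝ (Fin 5)), Manifold.IsSmoothEmbedding (𝓡 4) (𝓡 5) ∞ ι →
    gaussianEntropy 4 (range ι) ≤ gaussianEntropy 4 (shrinkingCylinder 4 3) →
    ∀ ε : ℝ, 0 < ε →
      ∃ (F : ℝ → M → EuclideanSpace ℝ (Fin 5))
        (ν : (t : ℝ) → Lorentzian.NormalField (𝓡 5) (F t)) (T : ℝ)
        (c : EuclideanSpace ℝ (Fin 5)) (G : M → EuclideanSpace ℝ (Fin 5)),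
        0 < T ∧ (∀ x, ‖F 0 x - ι x‖ ≤ ε) ∧
        (∀ b : ℝ, b < T → IsClassicalMCF (euclideanMetric (EuclideanSpace ℝ (Fin 5))) F ν 0 b) ∧
        Manifold.IsSmoothEmbedding (𝓡 4) (𝓡 5) ∞ G ∧
        range G = sphere (0 : EuclideanSpace ℝ (Fin 5)) (Real.sqrt 8) ∧
        TendstoUniformly (fun (t : ℝ) (x : M) => (Real.sqrt (T - t))⁻¹ • (F t x - c)) G (𝓝[<] T)

/-- **Chodosh–Mantoulidis–Schulze 2025, Cor. 1.5 (b) / Cor. 1.22 (b) for `n = 4`, simply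
connected case** ("If `λ(M) ≤ λ(𝕊ⁿ⁻²)` then perhaps after a small initial `C^∞` perturbation, the
mean curvature flow with surgery of [Daniels-Holgate] provides a smooth isotopy from `M` to the
boundary of a standard handlebody that is either a standard ball `Bⁿ` or a boundary connect sum of
finitely many `Bⁿ⁻¹ × 𝕊¹`'s"; for simply connected `M` only `∂B⁵ = 𝕊⁴` can occur,
`π₁(#ₖ 𝕊¹ × 𝕊³) = F_k`): a simply connected compact connected `C^∞` `4`-manifold with a `C^∞`
embedding into `ℝ⁵` of entropy `≤ λ(shrinkingCylinder 4 2)` (`= λ(𝕊²) = 4/e`) is diffeomorphic to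
the standard `𝕊⁴`. This is the second conjunct of `ChodoshMantoulidisSchulze2025_lowEntropy_sphere_four`,
verbatim — a printed statement distinct from (a) (its threshold `4/e` is strictly above `λ(𝕊³)`,
and it needs simple connectivity) whose proof, the flow WITH SURGERY, has no rendering in the
tree's vocabulary yet. [cite: ChodoshMantoulidisSchulze2025, Cor. 1.5 (b) and Cor. 1.22 (b) (n = 4)]
[cite: DanielsHolgate2022] -/
def ChodoshMantoulidisSchulze2025_cor15b_four : Prop :=
  ∀ (M : Type) [TopologicalSpace M] [T2Space M] [SecondCountableTopology M] [CompactSpace M]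
    [ConnectedSpace M] [ChartedSpace (EuclideanSpace ℝ (Fin 4)) M] [IsManifold (𝓡 4) ∞ M],
    SimplyConnectedSpace M → ∀ (ι : M → EuclideanSpace ℝ (Fin 5)),
    Manifold.IsSmoothEmbedding (𝓡 4) (𝓡 5) ∞ ι →
    gaussianEntropy 4 (range ι) ≤ gaussianEntropy 4 (shrinkingCylinder 4 2) →
      Nonempty (M ≃ₘ⟮𝓡 4, 𝓡 4⟯ (Metric.sphere (0 : EuclideanSpace ℝ (Fin 5)) 1))

/-- **Assembly (proof of Cor. 1.22, p. 6, with the isotopy-endpoint step).** Clause (a) of the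
parent from the flow: the limit `G` of the rescaled flow is a `C^∞` embedding of `M` onto the round
sphere `sphere 0 √8`, hence `M ≅ 𝕊⁴` by `nonempty_diffeomorph_sphere_four_of_range_eq_sphere`
(PROVED in `LowEntropyHypersurfacesFourProofs`); clause (b) is `ChodoshMantoulidisSchulze2025_cor15b_four`.
[cite: ChodoshMantoulidisSchulze2025, Cor. 1.22, proof p. 6] -/
theorem ChodoshMantoulidisSchulze2025_lowEntropy_sphere_four_holds_of
    (ha : ChodoshMantoulidisSchulze2025_smoothFlow_roundPoint_four)
    (hb : ChodoshMantoulidisSchulze2025_cor15b_four) :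
    ChodoshMantoulidisSchulze2025_lowEntropy_sphere_four := by
  refine ⟨fun M _ _ _ _ _ _ _ ι hι hent => ?_, hb⟩
  obtain ⟨F, ν, T, c, G, -, -, -, hG, hGr, -⟩ := ha M ι hι hent 1 one_pos
  exact nonempty_diffeomorph_sphere_four_of_range_eq_sphere M hG
    (Real.sqrt_pos.2 (by norm_num)) hGr

end Literature.Geometry.Riemannian

end
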